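import Mathlib
import Literature.NumberTheory.LFunctions.Zhang2022.SkeletonPartThree
import Literature.NumberTheory.LFunctions.Zhang2022.Section3Lemma33
import Literature.NumberTheory.LFunctions.HuxleyLargeValuesFourthMomentProofs
import HarnessLib

/-!
# Zhang (2022) §8 p. 43, Z22:§8.u014: `Σ_{ψ∈Ψ₁} |A(a₁;s,ψ)A(a₂;1−s,ψ̄)|² ≪ P²𝓛³⁶` on `𝔍(α)`,
# PROVED unconditionally (Cauchy + Lemma 3.3 (ii) + `Σ_{m≤P²} τ(m)²/m ≤ (1 + log P²)⁴`)

Topic `Literature/NumberTheory/LFunctions/Zhang2022` (Landau–Siegel adjudication tree;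
verdict-neutral). Y. Zhang, *Discrete mean estimates and the Landau–Siegel zero*,
arXiv:2211.02515v1 (2022) [Zhang2022LandauSiegel] — **an unrefereed manuscript under
adjudication.** Cell siegel-zhang (D-0069 width campaign), proof of Lemma 8.1 (Z22:Lem8.1.pf,
pp. 42–44), the step Z22:§8.u014 (p. 43, tex L2248–2250):

> By Cauchy's inequality, Lemma 6.1, and the second assertion of Lemma 3.3, for `s ∈ 𝔍(α)`, […]
> `Σ_{ψ∈Ψ₁} |A(𝐚₁;s,ψ)A(𝐚₂,1−s,ψ̄)|² ≪ P²𝓛³⁶`.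

(`A(𝐚;s,ψ) = Σ_{n<PT⁻²} a(n)ψ(n)n^{−s}` with `a(n) ≪ 1`, (7.2); `𝔍(α)`: `s = α + s₀ + iv`,
`|v| ≤ 𝓛₁`.) This file PROVES the display — in the typed shape of the node
`Section8aStatements.Step8u014` (L2-t7, p412578; here with its `onJ` unfolded, `step8u014_body`) —
from the tree's Lemma 3.3 (ii) (`Skeleton.lemma33b_holds`, large sieve) alone:
`2|A₁|²|A₂|² ≤ |A₁|⁴ + |A₂|⁴`; `|A|⁴ = |A²|²` with `A²` a Dirichlet polynomial of length
`(⌈PT⁻²⌉ − 1)² ≤ P²` and coefficients `|(a∗a)(m)| ≤ B²τ(m)` (`dirPoly_sq_eq`, `norm_sqCoeff_le`);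
Lemma 3.3 (ii) over all of `Ψ ⊇ Ψ₁`; `m^{−1−2α} ≤ m⁻¹` and `m^{−1+2α} ≤ (P²)^{2α}m⁻¹ = e^{4π}m⁻¹`
(`α log P = π`) for the two abscissae `Re s = ½ + α`, `Re(1 − s) = ½ − α` (the `ψ̄`-polynomial is
handled by `|A(a₂;1−s,ψ̄)| = |A(ā₂;conj(1−s),ψ)|`); and Ivić's `Σ_{m≤K} τ(m)²/m ≤ (1 + log K)⁴`
(tree `ZetaM4D.sum_card_divisors_sq_div_le`), `1 + log P² ≤ 3𝓛⁹`. Lemma 6.1 and hypothesis (A)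
are not needed for this half of the display (they enter its companion §8.u013).

* `dirPoly_sq_eq`, `norm_sqCoeff_le` — squaring a Dirichlet polynomial; the divisor bound;
* `finsum_norm_dirPoly_pow_four_le` — `Σ_{ψ∈Ψ}|A(a;w,ψ)|⁴ ≤ C₃₃P²·B⁴E(1 + log⌊P²⌋)⁴`;
* `step8u014_body` — **Z22:§8.u014**, for every `B`: eventually
  `Σ_{ψ∈Ψ₁}|A(a₁;s,ψ)A(a₂;1−s,ψ̄)|² ≤ C·P²𝓛³⁶` on `𝔍(α)`, `C = max(C₃₃,0)·B⁴(1+e^{4π})·81/2`.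

No definitions, no new named facts. WHAT THIS IS NOT: any claim about the other steps of Lemma 8.1's
proof, Theorems 1–2 of the source, or Landau–Siegel zeros.

## References

* Y. Zhang, arXiv:2211.02515v1 (2022), §8 p. 43 (proof of Lemma 8.1); §3 Lemma 3.3; §7 (7.2).
  [cite: Zhang2022LandauSiegel, §8 p. 43]
* A. Ivić, *The Riemann zeta-function* (1985), (5.25). [cite: Ivic1985, (5.25)]
-/

noncomputable section

open Complex Real ComplexConjugate Finset

namespace Literature.NumberTheory.LFunctions.Zhang2022.Ded81Edge

open Skeleton

/-! ## §1. The square of a Dirichlet polynomial is a Dirichlet polynomial -/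

/-- A Dirichlet character to a modulus `k ≠ 1` vanishes at `0`. [folklore] -/
private theorem apply_zero_of_ne_one {k : ℕ} [NeZero k] (θ : DirichletCharacter ℂ k)
    (hk : k ≠ 1) : θ (0 : ZMod k) = 0 := by
  haveI : Nontrivial (ZMod k) := ZMod.nontrivial_iff.mpr hk
  exact MulChar.map_nonunit θ not_isUnit_zero

/-- `A(a;s,θ) = Σ_{1≤n<N} a(n)θ(n)n^{−s}` (the `n = 0` term of `Lemma81.dirPoly` vanishes, `θ(0) = 0`).
[cite: Zhang2022LandauSiegel, §7 p. 32 (after (7.2))] -/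
theorem dirPoly_eq_sum_Ico {k : ℕ} [NeZero k] (N : ℕ) (a : ℕ → ℂ) (θ : DirichletCharacter ℂ k)
    (hk : k ≠ 1) (w : ℂ) :
    Lemma81.dirPoly N a θ w = ∑ n ∈ Ico 1 N, a n * θ n * (n : ℂ) ^ (-w) := by
  rw [Lemma81.dirPoly_def]
  rcases Nat.eq_zero_or_pos N with rfl | hN
  · simp
  · rw [Finset.range_eq_Ico, Finset.sum_eq_sum_Ico_succ_bot hN, Nat.cast_zero,
      apply_zero_of_ne_one θ hk]
    simp

/-- **`A(a;s,θ)² = Σ_{1≤m≤M} (a∗a)(m)θ(m)m^{−s}`** for any `M ≥ (N−1)²`: the square of a Dirichlet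
polynomial of length `N` is a Dirichlet polynomial of length `(N−1)²` ("Cauchy's inequality" step of
§8 p. 43 prepares `|A|⁴ = |A²|²` for the large sieve). [cite: Zhang2022LandauSiegel, §8 p. 43] -/
theorem dirPoly_sq_eq {k : ℕ} [NeZero k] (N : ℕ) (a : ℕ → ℂ) (θ : DirichletCharacter ℂ k)
    (hk : k ≠ 1) (w : ℂ) {M : ℕ} (hM : (N - 1) ^ 2 ≤ M) :
    Lemma81.dirPoly N a θ w ^ 2 =
      ∑ m ∈ Icc 1 M,
        (∑ p ∈ (Ico 1 N ×ˢ Ico 1 N).filter (fun p => p.1 * p.2 = m), a p.1 * a p.2) *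
          θ m * (m : ℂ) ^ (-w) := by
  have hmaps : ∀ p ∈ Ico 1 N ×ˢ Ico 1 N, p.1 * p.2 ∈ Icc 1 M := by
    intro p hp
    rw [Finset.mem_product, Finset.mem_Ico, Finset.mem_Ico] at hp
    rw [Finset.mem_Icc]
    refine ⟨Nat.one_le_iff_ne_zero.mpr (Nat.mul_ne_zero (by omega) (by omega)), ?_⟩
    calc p.1 * p.2 ≤ (N - 1) * (N - 1) := Nat.mul_le_mul (by omega) (by omega)
      _ = (N - 1) ^ 2 := (sq _).symm
      _ ≤ M := hM
  rw [dirPoly_eq_sum_Ico N a θ hk, sq, Finset.sum_mul_sum, ← Finset.sum_product']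
  rw [← Finset.sum_fiberwise_of_maps_to hmaps]
  refine Finset.sum_congr rfl fun m _ => ?_
  rw [Finset.sum_mul, Finset.sum_mul]
  refine Finset.sum_congr rfl fun p hp => ?_
  obtain ⟨-, hpm⟩ := Finset.mem_filter.mp hp
  rw [← hpm]
  simp only [Nat.cast_mul, map_mul, Complex.natCast_mul_natCast_cpow]
  ring

/-- `#{(n₁,n₂) : n₁n₂ = m} = τ(m)`. [folklore] -/
private theorem card_divisorsAntidiagonal' (m : ℕ) :
    m.divisorsAntidiagonal.card = m.divisors.card := by
  rw [← Nat.map_div_right_divisors, Finset.card_map]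

/-- **`|(a∗a)(m)| ≤ B²τ(m)`** when `|a(n)| ≤ B` (the divisor bound behind "`≪ P²𝓛³⁶`", §8 p. 43).
[cite: Zhang2022LandauSiegel, §8 p. 43] -/
theorem norm_sqCoeff_le (N : ℕ) {a : ℕ → ℂ} {B : ℝ} (hB : ∀ n, ‖a n‖ ≤ B) {m : ℕ} (hm : m ≠ 0) :
    ‖∑ p ∈ (Ico 1 N ×ˢ Ico 1 N).filter (fun p => p.1 * p.2 = m), a p.1 * a p.2‖ ≤
      B ^ 2 * m.divisors.card := by
  have hB0 : 0 ≤ B := le_trans (norm_nonneg _) (hB 0)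
  have hsub : (Ico 1 N ×ˢ Ico 1 N).filter (fun p => p.1 * p.2 = m) ⊆ m.divisorsAntidiagonal := by
    intro p hp
    obtain ⟨-, hpm⟩ := Finset.mem_filter.mp hp
    exact Nat.mem_divisorsAntidiagonal.mpr ⟨hpm, hm⟩
  calc ‖∑ p ∈ (Ico 1 N ×ˢ Ico 1 N).filter (fun p => p.1 * p.2 = m), a p.1 * a p.2‖
      ≤ ∑ p ∈ (Ico 1 N ×ˢ Ico 1 N).filter (fun p => p.1 * p.2 = m), ‖a p.1 * a p.2‖ :=
        norm_sum_le _ _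
    _ ≤ ∑ p ∈ (Ico 1 N ×ˢ Ico 1 N).filter (fun p => p.1 * p.2 = m), B ^ 2 := by
        refine Finset.sum_le_sum fun p _ => ?_
        rw [norm_mul, sq]
        exact mul_le_mul (hB _) (hB _) (norm_nonneg _) hB0
    _ = ((Ico 1 N ×ˢ Ico 1 N).filter (fun p => p.1 * p.2 = m)).card * B ^ 2 := by
        rw [Finset.sum_const, nsmul_eq_mul]
    _ ≤ m.divisorsAntidiagonal.card * B ^ 2 :=
        mul_le_mul_of_nonneg_right (by exact_mod_cast Finset.card_le_card hsub) (sq_nonneg _)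
    _ = B ^ 2 * m.divisors.card := by rw [card_divisorsAntidiagonal', mul_comm]

/-! ## §2. The fourth moment over `Ψ` via Lemma 3.3 (ii) -/

/-- **`Σ_{ψ∈Ψ} |A(a;w,ψ)|⁴ ≤ C·P²·B⁴E(1 + log⌊P²⌋)⁴`** ("Cauchy's inequality … and the second
assertion of Lemma 3.3", §8 p. 43): `|A|⁴ = |A²|²`, `A²` is a Dirichlet polynomial of length
`(⌈PT⁻²⌉ − 1)² ≤ P²` with coefficients `|(a∗a)(m)| ≤ B²τ(m)`, Lemma 3.3 (ii) (in the form `h33`, the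
tree's `Skeleton.lemma33b_holds`), `m^{−2Re w} ≤ E/m` on `m ≤ P²`, and Ivić (5.25)
`Σ_{m≤K} τ(m)²/m ≤ (1 + log K)⁴` (tree `ZetaM4D.sum_card_divisors_sq_div_le`).
[cite: Zhang2022LandauSiegel, §8 p. 43] -/
theorem finsum_norm_dirPoly_pow_four_le {D : ℕ} {C : ℝ} (hC : 0 ≤ C)
    (h33 : ∀ (s : ℂ) (c : ℕ → ℂ),
      ∑ᶠ x : Chr D, ‖∑ n ∈ Icc 1 ⌊bigP D ^ 2⌋₊, c n * x.ψ (n : ZMod x.p) * (n : ℂ) ^ (-s)‖ ^ 2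
        ≤ C * bigP D ^ 2 * ∑ n ∈ Icc 1 ⌊bigP D ^ 2⌋₊, ‖c n‖ ^ 2 * (n : ℝ) ^ (-2 * s.re))
    (hNM : (Nsupp D - 1) ^ 2 ≤ ⌊bigP D ^ 2⌋₊) {a : ℕ → ℂ} {B : ℝ} (hB : ∀ n, ‖a n‖ ≤ B)
    (w : ℂ) {E : ℝ} (hE0 : 0 ≤ E)
    (hE : ∀ m ∈ Icc 1 ⌊bigP D ^ 2⌋₊, (m : ℝ) ^ (-2 * w.re) ≤ E * (m : ℝ)⁻¹) :
    ∑ᶠ x : Chr D, ‖Lemma81.dirPoly (Nsupp D) a x.ψ w‖ ^ 4 ≤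
      C * bigP D ^ 2 * (B ^ 4 * E * (1 + Real.log ⌊bigP D ^ 2⌋₊) ^ 4) := by
  set M := ⌊bigP D ^ 2⌋₊ with hMdef
  set N := Nsupp D with hNdef
  set c : ℕ → ℂ := fun m => ∑ p ∈ (Ico 1 N ×ˢ Ico 1 N).filter (fun p => p.1 * p.2 = m),
    a p.1 * a p.2 with hcdef
  have hB0 : 0 ≤ B := le_trans (norm_nonneg _) (hB 0)
  have hsq : ∀ x : Chr D, ‖Lemma81.dirPoly N a x.ψ w‖ ^ 4 =
      ‖∑ m ∈ Icc 1 M, c m * x.ψ (m : ZMod x.p) * (m : ℂ) ^ (-w)‖ ^ 2 := by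
    intro x
    rw [show (4 : ℕ) = 2 * 2 from rfl, pow_mul, ← norm_pow,
      dirPoly_sq_eq N a x.ψ x.p_ne_one w hNM]
  rw [finsum_congr hsq]
  refine (h33 w c).trans ?_
  have hcoef : ∑ m ∈ Icc 1 M, ‖c m‖ ^ 2 * (m : ℝ) ^ (-2 * w.re) ≤
      B ^ 4 * E * ∑ m ∈ Icc 1 M, (m.divisors.card : ℝ) ^ 2 / m := by
    rw [Finset.mul_sum]
    refine Finset.sum_le_sum fun m hm => ?_
    have hm1 : 1 ≤ m := (Finset.mem_Icc.mp hm).1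
    have h1 : ‖c m‖ ^ 2 ≤ (B ^ 2 * m.divisors.card) ^ 2 :=
      pow_le_pow_left₀ (norm_nonneg _) (norm_sqCoeff_le N hB (by omega)) 2
    have h2 := hE m hm
    calc ‖c m‖ ^ 2 * (m : ℝ) ^ (-2 * w.re) ≤ (B ^ 2 * m.divisors.card) ^ 2 * (E * (m : ℝ)⁻¹) :=
          mul_le_mul h1 h2 (Real.rpow_nonneg (Nat.cast_nonneg m) _) (sq_nonneg _)
      _ = B ^ 4 * E * ((m.divisors.card : ℝ) ^ 2 / m) := by ring
  have hdiv : ∑ m ∈ Icc 1 M, (m.divisors.card : ℝ) ^ 2 / m ≤ (1 + Real.log M) ^ 4 :=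
    ZetaM4D.sum_card_divisors_sq_div_le M
  have hP2 : 0 ≤ C * bigP D ^ 2 := mul_nonneg hC (sq_nonneg _)
  calc C * bigP D ^ 2 * ∑ n ∈ Icc 1 M, ‖c n‖ ^ 2 * (n : ℝ) ^ (-2 * w.re)
      ≤ C * bigP D ^ 2 * (B ^ 4 * E * ∑ m ∈ Icc 1 M, (m.divisors.card : ℝ) ^ 2 / m) :=
        mul_le_mul_of_nonneg_left hcoef hP2
    _ ≤ C * bigP D ^ 2 * (B ^ 4 * E * (1 + Real.log M) ^ 4) := by
        refine mul_le_mul_of_nonneg_left (mul_le_mul_of_nonneg_left hdiv ?_) hP2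
        positivity

/-! ## §3. Z22:§8.u014 -/

/-- `A(a₂;1−s,ψ̄)` has the modulus of `A(ā₂; conj(1−s), ψ)` (conjugation; `conj ψ̄ = ψ`), so that
Lemma 3.3 (ii), stated over `ψ ∈ Ψ`, applies to it. [cite: Zhang2022LandauSiegel, §8 p. 43] -/
theorem norm_dirPoly_inv_eq {k : ℕ} [NeZero k] (N : ℕ) (a : ℕ → ℂ) (θ : DirichletCharacter ℂ k)
    (w : ℂ) :
    ‖Lemma81.dirPoly N a θ⁻¹ w‖ = ‖Lemma81.dirPoly N (fun n => conj (a n)) θ (conj w)‖ := by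
  have h := Lemma81.conj_dirPoly N (fun n => conj (a n)) θ (conj w)
  simp only [Complex.conj_conj] at h
  rw [← h, Complex.norm_conj]

/-- For large `D`: `1 ≤ 𝓛`, `α > 0`, `α·𝓛⁹ = π` (so `(P²)^{2α} = e^{4π}`), `1 ≤ ⌊P²⌋`,
`log⌊P²⌋ ≤ 2𝓛⁹` and `(⌈PT⁻²⌉ − 1)² ≤ ⌊P²⌋` (the length of `A²` is within Lemma 3.3 (ii)'s range).
[cite: Zhang2022LandauSiegel, §2 (2.6), (2.10); §7 (7.2)] -/
theorem exists_large_u014 : ∃ D₀ : ℕ, ∀ D : ℕ, D₀ ≤ D →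
    1 ≤ ell D ∧ 0 < alpha D ∧ alpha D * ell D ^ 9 = π ∧ 1 ≤ (⌊bigP D ^ 2⌋₊ : ℝ) ∧
      Real.log ⌊bigP D ^ 2⌋₊ ≤ 2 * ell D ^ 9 ∧ (Nsupp D - 1) ^ 2 ≤ ⌊bigP D ^ 2⌋₊ := by
  refine ⟨3, fun D hD => ?_⟩
  have hL1 : 1 < ell D := one_lt_ell hD
  have hL0 : 0 < ell D := by linarith
  have hα : alpha D = π / ell D ^ 9 := by rw [alpha, bigP, Real.log_exp]
  have hα0 : 0 < alpha D := by rw [hα]; positivity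
  have hαL : alpha D * ell D ^ 9 = π := by rw [hα]; field_simp
  have hP1 : 1 ≤ bigP D := by
    rw [bigP]; exact Real.one_le_exp (by positivity)
  have hP2 : (1 : ℝ) ≤ bigP D ^ 2 := one_le_pow₀ hP1
  have hM1 : 1 ≤ (⌊bigP D ^ 2⌋₊ : ℝ) := by exact_mod_cast Nat.le_floor (by exact_mod_cast hP2)
  have hMle : (⌊bigP D ^ 2⌋₊ : ℝ) ≤ bigP D ^ 2 := Nat.floor_le (by positivity)
  have hlogM : Real.log ⌊bigP D ^ 2⌋₊ ≤ 2 * ell D ^ 9 := by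
    calc Real.log ⌊bigP D ^ 2⌋₊ ≤ Real.log (bigP D ^ 2) :=
          Real.log_le_log (by linarith) hMle
      _ = 2 * ell D ^ 9 := by rw [Real.log_pow, bigP, Real.log_exp]; ring
  -- `⌈PT⁻²⌉ − 1 ≤ PT⁻² ≤ P`
  have hT1 : 1 ≤ bigT D := by rw [bigT]; exact Real.one_le_exp (by positivity)
  have hy0 : 0 ≤ bigP D / bigT D ^ 2 := by positivity
  have hN : ((Nsupp D - 1 : ℕ) : ℝ) ≤ bigP D := by
    have h1 : ((Nsupp D - 1 : ℕ) : ℝ) ≤ bigP D / bigT D ^ 2 := by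
      have hc : ((Nsupp D : ℕ) : ℝ) < bigP D / bigT D ^ 2 + 1 := Nat.ceil_lt_add_one hy0
      rcases Nat.eq_zero_or_pos (Nsupp D) with h0 | hpos
      · rw [h0]; simpa using hy0
      · rw [Nat.cast_sub hpos, Nat.cast_one]
        linarith
    have h2 : bigP D / bigT D ^ 2 ≤ bigP D := by
      rw [div_le_iff₀ (by positivity)]
      have : (1 : ℝ) ≤ bigT D ^ 2 := one_le_pow₀ hT1
      nlinarith
    exact h1.trans h2
  have hNM : (Nsupp D - 1) ^ 2 ≤ ⌊bigP D ^ 2⌋₊ := by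
    refine Nat.le_floor ?_
    push_cast
    exact pow_le_pow_left₀ (Nat.cast_nonneg _) hN 2
  exact ⟨hL1.le, hα0, hαL, hM1, hlogM, hNM⟩

/-- **Z22:§8.u014 HOLDS** (§8 p. 43, tex L2248–2250: "By Cauchy's inequality, Lemma 6.1, and the
second assertion of Lemma 3.3, for `s ∈ 𝔍(α)`, … `Σ_{ψ∈Ψ₁}|A(a₁;s,ψ)A(a₂,1−s,ψ̄)|² ≪ P²𝓛³⁶`"),
unconditionally, in the typed shape of `Section8aStatements.Step8u014` (L2-t7) with `onJ` unfolded: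
for every `B` there is `C` such that for all large `D`, all `a₁, a₂` satisfying (7.2) with bound
`B`, and every `s = α + s₀ + iv`, `|v| ≤ 𝓛₁`:
`Σ_{ψ∈Ψ₁} |A(a₁;s,ψ)A(a₂;1−s,ψ̄)|² ≤ C P²𝓛³⁶`. Proof: `2|A₁|²|A₂|² ≤ |A₁|⁴ + |A₂|⁴`; each fourth
moment over all of `Ψ` is `≤ C₃₃P²B⁴E(1+log P²)⁴` by `finsum_norm_dirPoly_pow_four_le` with `E = 1`
(`Re s = ½ + α`) resp. `E = (P²)^{2α} = e^{4π}` (`Re(1−s) = ½ − α`, after `|A(a₂;1−s,ψ̄)| =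
|A(ā₂;conj(1−s),ψ)|`); `1 + log P² ≤ 3𝓛⁹`. Only Lemma 3.3 (ii) is used (Lemma 6.1 enters the companion
bound §8.u013, not this one); hypothesis (A) is not needed. [cite: Zhang2022LandauSiegel, §8 p. 43] -/
theorem step8u014_body (B : ℝ) : ∃ C : ℝ, ForAllLarge fun D _ χ => AssumptionA D χ →
    ∀ a₁ a₂ : ℕ → ℂ, Adm72 D B a₁ → Adm72 D B a₂ → ∀ s : ℂ,
      (∃ v : ℝ, |v| ≤ ell1 D ∧ s = ((alpha D : ℝ) : ℂ) + s0 D + v * I) →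
        ∑ x ∈ finsetOf (PsiOne χ), ‖Apoly x a₁ s * ApolyBar x a₂ (1 - s)‖ ^ 2 ≤
          C * bigP D ^ 2 * ell D ^ 36 := by
  classical
  obtain ⟨C₃₃, h33⟩ := lemma33b_holds
  set C₀ := max C₃₃ 0 with hC₀
  have hC₀0 : 0 ≤ C₀ := le_max_right _ _
  obtain ⟨D₀, hD₀⟩ := exists_large_u014
  refine ⟨C₀ * (B ^ 4 * (1 + Real.exp (4 * π)) * 81) / 2,
    ForAllLarge.of_le D₀ fun D _ χ hD _ _ _ a₁ a₂ ha₁ ha₂ s hs => ?_⟩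
  haveI : Fintype (Chr D) := Fintype.ofFinite (Chr D)
  obtain ⟨hL1, hα0, hαL, hM1, hlogM, hNM⟩ := hD₀ D hD
  obtain ⟨v, -, rfl⟩ := hs
  set M := ⌊bigP D ^ 2⌋₊ with hMdef
  set w₁ : ℂ := ((alpha D : ℝ) : ℂ) + s0 D + v * I with hw₁
  set w₂ : ℂ := conj (1 - w₁) with hw₂
  have hre₁ : w₁.re = 1 / 2 + alpha D := by
    rw [hw₁, s0, SmoothWeight.s0_def]; simp; ring
  have hre₂ : w₂.re = 1 / 2 - alpha D := by
    rw [hw₂, Complex.conj_re, Complex.sub_re, Complex.one_re, hre₁]; ring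
  have h33' : ∀ (s : ℂ) (c : ℕ → ℂ),
      ∑ᶠ x : Chr D, ‖∑ n ∈ Icc 1 M, c n * x.ψ (n : ZMod x.p) * (n : ℂ) ^ (-s)‖ ^ 2
        ≤ C₀ * bigP D ^ 2 * ∑ n ∈ Icc 1 M, ‖c n‖ ^ 2 * (n : ℝ) ^ (-2 * s.re) := by
    intro s c
    refine (h33 D s c).trans (mul_le_mul_of_nonneg_right ?_ (Finset.sum_nonneg fun n _ =>
      mul_nonneg (sq_nonneg _) (Real.rpow_nonneg (Nat.cast_nonneg n) _)))
    exact mul_le_mul_of_nonneg_right (le_max_left _ _) (sq_nonneg _)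
  -- exponent comparisons `m^{−2Re w} ≤ E/m` on `1 ≤ m ≤ M`
  have hE₁ : ∀ m ∈ Icc 1 M, (m : ℝ) ^ (-2 * w₁.re) ≤ 1 * (m : ℝ)⁻¹ := by
    intro m hm
    have hm1 : (1 : ℝ) ≤ m := by exact_mod_cast (Finset.mem_Icc.mp hm).1
    rw [one_mul, ← Real.rpow_neg_one]
    exact Real.rpow_le_rpow_of_exponent_le hm1 (by rw [hre₁]; linarith)
  have hexp : (bigP D ^ 2) ^ (2 * alpha D) = Real.exp (4 * π) := by
    rw [bigP, ← Real.exp_nat_mul, ← Real.exp_mul]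
    congr 1
    push_cast
    linear_combination 4 * hαL
  have hE₂ : ∀ m ∈ Icc 1 M, (m : ℝ) ^ (-2 * w₂.re) ≤ Real.exp (4 * π) * (m : ℝ)⁻¹ := by
    intro m hm
    have hm1 : (1 : ℝ) ≤ m := by exact_mod_cast (Finset.mem_Icc.mp hm).1
    have hmM : (m : ℝ) ≤ bigP D ^ 2 :=
      le_trans (by exact_mod_cast (Finset.mem_Icc.mp hm).2) (Nat.floor_le (by positivity))
    have hm0 : (0 : ℝ) < m := by linarith
    rw [hre₂, show -2 * (1 / 2 - alpha D) = 2 * alpha D + (-1) by ring,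
      Real.rpow_add hm0, Real.rpow_neg_one, ← hexp]
    exact mul_le_mul_of_nonneg_right
      (Real.rpow_le_rpow hm0.le hmM (by linarith)) (inv_nonneg.mpr hm0.le)
  -- the two fourth moments
  have h4₁ := finsum_norm_dirPoly_pow_four_le hC₀0 h33' hNM ha₁.1 w₁ zero_le_one hE₁
  have ha₂c : ∀ n, ‖conj (a₂ n)‖ ≤ B := fun n => by rw [Complex.norm_conj]; exact ha₂.1 n
  have h4₂ := finsum_norm_dirPoly_pow_four_le hC₀0 h33' hNM (a := fun n => conj (a₂ n)) ha₂c w₂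
    (Real.exp_pos _).le hE₂
  rw [finsum_eq_sum_of_fintype] at h4₁ h4₂
  -- pointwise: `|A₁A₂|² = |A₁|²|A₂'|² ≤ ½(|A₁|⁴ + |A₂'|⁴)`
  have hpt : ∀ x : Chr D, ‖Apoly x a₁ w₁ * ApolyBar x a₂ (1 - w₁)‖ ^ 2 ≤
      (‖Lemma81.dirPoly (Nsupp D) a₁ x.ψ w₁‖ ^ 4 +
        ‖Lemma81.dirPoly (Nsupp D) (fun n => conj (a₂ n)) x.ψ w₂‖ ^ 4) / 2 := by
    intro x
    rw [Apoly, ApolyBar, norm_mul, norm_dirPoly_inv_eq, mul_pow]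
    nlinarith [sq_nonneg (‖Lemma81.dirPoly (Nsupp D) a₁ x.ψ w₁‖ ^ 2 -
      ‖Lemma81.dirPoly (Nsupp D) (fun n => conj (a₂ n)) x.ψ w₂‖ ^ 2)]
  have hlog : (1 + Real.log M) ^ 4 ≤ 81 * ell D ^ 36 := by
    have h1 : 1 + Real.log M ≤ 3 * ell D ^ 9 := by
      have : (1 : ℝ) ≤ ell D ^ 9 := one_le_pow₀ hL1
      linarith
    have h0 : 0 ≤ 1 + Real.log M := by
      have : 0 ≤ Real.log M := Real.log_nonneg hM1
      linarith
    calc (1 + Real.log M) ^ 4 ≤ (3 * ell D ^ 9) ^ 4 := pow_le_pow_left₀ h0 h1 4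
      _ = 81 * ell D ^ 36 := by ring
  have hB0 : 0 ≤ B := le_trans (norm_nonneg _) (ha₁.1 0)
  calc ∑ x ∈ finsetOf (PsiOne χ), ‖Apoly x a₁ w₁ * ApolyBar x a₂ (1 - w₁)‖ ^ 2
      ≤ ∑ x : Chr D, ‖Apoly x a₁ w₁ * ApolyBar x a₂ (1 - w₁)‖ ^ 2 :=
        Finset.sum_le_sum_of_subset_of_nonneg (Finset.subset_univ _) fun x _ _ => sq_nonneg _
    _ ≤ ∑ x : Chr D, (‖Lemma81.dirPoly (Nsupp D) a₁ x.ψ w₁‖ ^ 4 +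
          ‖Lemma81.dirPoly (Nsupp D) (fun n => conj (a₂ n)) x.ψ w₂‖ ^ 4) / 2 :=
        Finset.sum_le_sum fun x _ => hpt x
    _ = ((∑ x : Chr D, ‖Lemma81.dirPoly (Nsupp D) a₁ x.ψ w₁‖ ^ 4) +
          ∑ x : Chr D, ‖Lemma81.dirPoly (Nsupp D) (fun n => conj (a₂ n)) x.ψ w₂‖ ^ 4) / 2 := by
        rw [← Finset.sum_add_distrib, Finset.sum_div]
    _ ≤ (C₀ * bigP D ^ 2 * (B ^ 4 * 1 * (1 + Real.log M) ^ 4) +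
          C₀ * bigP D ^ 2 * (B ^ 4 * Real.exp (4 * π) * (1 + Real.log M) ^ 4)) / 2 := by
        gcongr
    _ = C₀ * bigP D ^ 2 * (B ^ 4 * (1 + Real.exp (4 * π))) * (1 + Real.log M) ^ 4 / 2 := by ring
    _ ≤ C₀ * bigP D ^ 2 * (B ^ 4 * (1 + Real.exp (4 * π))) * (81 * ell D ^ 36) / 2 := by
        gcongr
    _ = C₀ * (B ^ 4 * (1 + Real.exp (4 * π)) * 81) / 2 * bigP D ^ 2 * ell D ^ 36 := by ring

end Literature.NumberTheory.LFunctions.Zhang2022.Ded81Edge
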